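import Literature.MathematicalPhysics.KineticTheory.HardSphereJumpTelescoping
import Literature.MathematicalPhysics.KineticTheory.HardSphereBinnedJumpStatics
import HarnessLib

/-!
# Binned, clamped collision-jump payloads, II: the pathwise bound over the counted collisions

Topic `Literature/MathematicalPhysics/KineticTheory`, continuing `HardSphereJumpTelescoping` and
`HardSphereBinnedJumpStatics`.  Along a good orbit of a hard-sphere flow on `𝕋^d`, the binned jump
payloads `C·rφ⌊φ(xᵢ(tₙ))/rφ⌋·(rg⌊g(vᵢ(tₙ))/rg⌋ - rg⌊g(vᵢ(tₙ⁻))/rg⌋)` of particle `i` over its first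
`min(Jᵢ, K+1)` collisions `tₙ` of the window `(0, h]` total at most
`C(2b + (K+1)(2rφ(b+rg)+2rg)) + CbD∫₀ʰ‖vᵢ‖` (binning error per counted jump, and the telescoping bound
`HardSphereFlow.abs_sum_range_jumpPayload_le` of the exact payloads):
`HardSphereFlow.abs_sum_range_ite_binnedJumpPayload_le`; summed over the particles,
`HardSphereFlow.abs_sum_sum_range_ite_binnedJumpPayload_le`.  Also `measurable_binnedJumpPayload`: the
binned payload (pre-collisional velocity read through the partner) is measurable in the configuration.
No new definitions.

## References

* C. Kipnis, C. Landim, *Scaling Limits of Interacting Particle Systems* (1999), App. 1 §5–6.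
* I. Gallagher, L. Saint-Raymond, B. Texier, *From Newton to Boltzmann* (2013), §4.1.
-/

noncomputable section

namespace Literature.MathematicalPhysics.KineticTheory

open _root_.MeasureTheory Set Filter Function
open scoped ENNReal BigOperators
open Literature.Analysis.FluidPDE

/-! ### The binned jump payload is measurable in the configuration -/

/-- **The binned jump payload of particle `i` is a measurable function of the configuration**
(measurable separation map; `φ`, `g` measurable): `C · rφ⌊φ(xᵢ)/rφ⌋ · (rg⌊g(vᵢ)/rg⌋ - rg⌊g(vᵢ⁻)/rg⌋)`,
the pre-collisional velocity `vᵢ⁻` read through the partner (`measurable_preVel_partner`). [folklore] -/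
theorem measurable_binnedJumpPayload {d : Type*} [Fintype d] {X : Type*} [MeasurableSpace X] {N : ℕ}
    {G : Geometry d X} (hG : Measurable fun p : X × X => G.sepVec p.1 p.2) (ε t₀ : ℝ)
    {φ : X → ℝ} (hφ : Measurable φ) {g : EuclideanSpace ℝ d → ℝ} (hg : Measurable g)
    (C rφ rg : ℝ) (i : Fin N) :
    Measurable fun ζ : Config N d X =>
      C * (rφ * ((⌊φ (ζ i).1 / rφ⌋ : ℤ) : ℝ)) *
        (rg * ((⌊g (ζ i).2 / rg⌋ : ℤ) : ℝ) -
          rg * ((⌊g (HardSphereCollisionRecord.ofConfig G ε ζ t₀ i (partner G ε ζ i)).preVel.1 / rg⌋ :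
            ℤ) : ℝ)) := by
  have h1 : Measurable fun ζ : Config N d X => (ζ i).1 := (measurable_pi_apply i).fst
  have h2 : Measurable fun ζ : Config N d X => (ζ i).2 := (measurable_pi_apply i).snd
  have h3 := measurable_preVel_partner (N := N) hG ε t₀ i
  exact (measurable_const.mul ((measurable_mul_floor_div rφ).comp (hφ.comp h1))).mul
    (((measurable_mul_floor_div rg).comp (hg.comp h2)).sub
      ((measurable_mul_floor_div rg).comp (hg.comp h3)))

/-! ### The pathwise bound for the binned payloads of one particle over its counted collisions -/

section Flow

variable {d : Type*} [Fintype d] {ε : ℝ} {N : ℕ}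

/-- **Binned jump payloads over the counted collisions of one particle.**  On the good set of a
hard-sphere flow on `𝕋^d` (`ε < 1/2`), for a particle `i`, a window `(0, h]` (`h ≥ 0`), a clamp index
`K`, a constant `C ≥ 0`, meshes `0 < rφ`, `0 < rg`, a position weight `φ` (`|φ| ≤ 1`,
`|φ x - φ y| ≤ D dist x y`, `D ≥ 0`) and a velocity observable `g` (`|g| ≤ b`): the sum over `n ≤ K`
with `n < Jᵢ` of the binned payloads `C·rφ⌊φ(xᵢ(tₙ))/rφ⌋·(rg⌊g(vᵢ(tₙ))/rg⌋ - rg⌊g(vᵢ(tₙ⁻))/rg⌋)` is at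
most `C(2b + (K+1)(2rφ(b+rg)+2rg)) + CbD∫₀ʰ‖vᵢ(s)‖ds` in absolute value (binning error
`abs_binned_sub_exact_le` per counted jump; telescoping `HardSphereFlow.abs_sum_range_jumpPayload_le`
of the exact payloads).  Dot-notation extension of `Literature.Analysis.FluidPDE.HardSphereFlow`.
[folklore] -/
theorem _root_.Literature.Analysis.FluidPDE.HardSphereFlow.abs_sum_range_ite_binnedJumpPayload_le
    (hε : ε < 2⁻¹) (Φ : HardSphereFlow (Torus.geometry d) ε N) {z : Config N d (UnitAddTorus d)}
    (hz : z ∈ Φ.good) (i : Fin N) {h : ℝ} (hh : 0 ≤ h) (K : ℕ) {C rφ rg : ℝ} (hC : 0 ≤ C)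
    (hrφ : 0 < rφ) (hrg : 0 < rg) {φ : UnitAddTorus d → ℝ} {D : ℝ} (hD : 0 ≤ D)
    (hφ1 : ∀ x, |φ x| ≤ 1) (hφD : ∀ x y, |φ x - φ y| ≤ D * dist x y) {g : EuclideanSpace ℝ d → ℝ}
    {b : ℝ} (hg : ∀ v, |g v| ≤ b) (t₀ : ℝ) :
    |∑ n ∈ Finset.range (K + 1),
      (if n < (collisionTimesOf (Torus.geometry d) ε (fun s => Φ.flow s z) i ∩ Ioc 0 h).ncard then
        C * (rφ * ((⌊φ (Φ.flow (Φ.nthCollisionTimeOf i n z) z i).1 / rφ⌋ : ℤ) : ℝ)) *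
          (rg * ((⌊g (Φ.flow (Φ.nthCollisionTimeOf i n z) z i).2 / rg⌋ : ℤ) : ℝ) -
            rg * ((⌊g (HardSphereCollisionRecord.ofConfig (Torus.geometry d) ε
              (Φ.flow (Φ.nthCollisionTimeOf i n z) z) t₀ i
              (partner (Torus.geometry d) ε (Φ.flow (Φ.nthCollisionTimeOf i n z) z) i)).preVel.1 /
                rg⌋ : ℤ) : ℝ))
      else 0)| ≤
      C * (2 * b + ((K : ℝ) + 1) * (2 * rφ * (b + rg) + 2 * rg)) +
        C * b * D * ∫ s in (0 : ℝ)..h, ‖(Φ.flow s z i).2‖ := by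
  set J := (collisionTimesOf (Torus.geometry d) ε (fun s => Φ.flow s z) i ∩ Ioc 0 h).ncard with hJ
  set T : ℕ → ℝ := fun n => Φ.nthCollisionTimeOf i n z with hT
  set pre : ℕ → EuclideanSpace ℝ d := fun n =>
    (HardSphereCollisionRecord.ofConfig (Torus.geometry d) ε (Φ.flow (T n) z) t₀ i
      (partner (Torus.geometry d) ε (Φ.flow (T n) z) i)).preVel.1 with hpre
  set e := 2 * rφ * (b + rg) + 2 * rg with he
  have hb : 0 ≤ b := (abs_nonneg _).trans (hg 0)
  have he0 : 0 ≤ e := by rw [he]; positivity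
  -- exact and binned payloads
  set ex : ℕ → ℝ := fun n => φ (Φ.flow (T n) z i).1 * (g (Φ.flow (T n) z i).2 - g (pre n)) with hex
  set bi : ℕ → ℝ := fun n => C * (rφ * ((⌊φ (Φ.flow (T n) z i).1 / rφ⌋ : ℤ) : ℝ)) *
    (rg * ((⌊g (Φ.flow (T n) z i).2 / rg⌋ : ℤ) : ℝ) - rg * ((⌊g (pre n) / rg⌋ : ℤ) : ℝ)) with hbi
  have hfilt : ∑ n ∈ Finset.range (K + 1), (if n < J then bi n else 0) =
      ∑ n ∈ Finset.range (min J (K + 1)), bi n := by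
    rw [← Finset.sum_filter]
    refine Finset.sum_congr ?_ fun _ _ => rfl
    ext n
    simp only [Finset.mem_filter, Finset.mem_range, lt_min_iff]
    exact and_comm
  change |∑ n ∈ Finset.range (K + 1), (if n < J then bi n else 0)| ≤ _
  rw [hfilt]
  set J' := min J (K + 1) with hJ'
  have hJ'K : (J' : ℝ) ≤ (K : ℝ) + 1 := by exact_mod_cast min_le_right J (K + 1)
  -- the exact payloads telescope
  have hexact : |∑ n ∈ Finset.range J', ex n| ≤ 2 * b + b * D * ∫ s in (0 : ℝ)..h, ‖(Φ.flow s z i).2‖ :=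
    Φ.abs_sum_range_jumpPayload_le hε hz i hh (min_le_left _ _) hD hφ1 hφD hg t₀
  -- the binning error
  have hbin : ∀ n, |bi n - C * ex n| ≤ C * e := by
    intro n
    have h := abs_binned_sub_exact_le (hφ1 (Φ.flow (T n) z i).1)
      (abs_mul_floor_div_sub_le hrφ (φ (Φ.flow (T n) z i).1))
      (abs_mul_floor_div_le hrg (hg (Φ.flow (T n) z i).2)) (abs_mul_floor_div_le hrg (hg (pre n)))
      (abs_mul_floor_div_sub_le hrg (g (Φ.flow (T n) z i).2)) (abs_mul_floor_div_sub_le hrg (g (pre n)))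
    have hfac : bi n - C * ex n = C * (rφ * ((⌊φ (Φ.flow (T n) z i).1 / rφ⌋ : ℤ) : ℝ) *
        (rg * ((⌊g (Φ.flow (T n) z i).2 / rg⌋ : ℤ) : ℝ) - rg * ((⌊g (pre n) / rg⌋ : ℤ) : ℝ)) -
          φ (Φ.flow (T n) z i).1 * (g (Φ.flow (T n) z i).2 - g (pre n))) := by
      rw [hbi, hex]; ring
    rw [hfac, abs_mul, abs_of_nonneg hC]
    exact mul_le_mul_of_nonneg_left h hC
  have hsplit : ∑ n ∈ Finset.range J', bi n =
      C * ∑ n ∈ Finset.range J', ex n + ∑ n ∈ Finset.range J', (bi n - C * ex n) := by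
    rw [Finset.mul_sum, ← Finset.sum_add_distrib]
    exact Finset.sum_congr rfl fun n _ => by ring
  rw [hsplit]
  calc |C * ∑ n ∈ Finset.range J', ex n + ∑ n ∈ Finset.range J', (bi n - C * ex n)|
      ≤ |C * ∑ n ∈ Finset.range J', ex n| + |∑ n ∈ Finset.range J', (bi n - C * ex n)| :=
        abs_add_le _ _
    _ ≤ C * (2 * b + b * D * ∫ s in (0 : ℝ)..h, ‖(Φ.flow s z i).2‖) + (J' : ℝ) * (C * e) := by
        refine add_le_add ?_ ?_
        · rw [abs_mul, abs_of_nonneg hC]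
          exact mul_le_mul_of_nonneg_left hexact hC
        · refine (Finset.abs_sum_le_sum_abs _ _).trans ?_
          refine (Finset.sum_le_sum fun n _ => hbin n).trans ?_
          rw [Finset.sum_const, Finset.card_range, nsmul_eq_mul]
    _ ≤ C * (2 * b + b * D * ∫ s in (0 : ℝ)..h, ‖(Φ.flow s z i).2‖) + ((K : ℝ) + 1) * (C * e) := by
        exact add_le_add le_rfl (mul_le_mul_of_nonneg_right hJ'K (mul_nonneg hC he0))
    _ = _ := by ring

/-- **Summed over the particles**: with `Lᵢ = ∫₀ʰ‖vᵢ‖`, the binned clamped payloads of all particles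
total at most `N·C(2b + (K+1)(2rφ(b+rg)+2rg)) + CbD Σᵢ Lᵢ` in absolute value.  Dot-notation
extension of `Literature.Analysis.FluidPDE.HardSphereFlow`. [folklore] -/
theorem _root_.Literature.Analysis.FluidPDE.HardSphereFlow.abs_sum_sum_range_ite_binnedJumpPayload_le
    (hε : ε < 2⁻¹) (Φ : HardSphereFlow (Torus.geometry d) ε N) {z : Config N d (UnitAddTorus d)}
    (hz : z ∈ Φ.good) {h : ℝ} (hh : 0 ≤ h) (K : ℕ) {C rφ rg : ℝ} (hC : 0 ≤ C)
    (hrφ : 0 < rφ) (hrg : 0 < rg) {φ : UnitAddTorus d → ℝ} {D : ℝ} (hD : 0 ≤ D)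
    (hφ1 : ∀ x, |φ x| ≤ 1) (hφD : ∀ x y, |φ x - φ y| ≤ D * dist x y) {g : EuclideanSpace ℝ d → ℝ}
    {b : ℝ} (hg : ∀ v, |g v| ≤ b) (t₀ : ℝ) :
    |∑ i, ∑ n ∈ Finset.range (K + 1),
      (if n < (collisionTimesOf (Torus.geometry d) ε (fun s => Φ.flow s z) i ∩ Ioc 0 h).ncard then
        C * (rφ * ((⌊φ (Φ.flow (Φ.nthCollisionTimeOf i n z) z i).1 / rφ⌋ : ℤ) : ℝ)) *
          (rg * ((⌊g (Φ.flow (Φ.nthCollisionTimeOf i n z) z i).2 / rg⌋ : ℤ) : ℝ) -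
            rg * ((⌊g (HardSphereCollisionRecord.ofConfig (Torus.geometry d) ε
              (Φ.flow (Φ.nthCollisionTimeOf i n z) z) t₀ i
              (partner (Torus.geometry d) ε (Φ.flow (Φ.nthCollisionTimeOf i n z) z) i)).preVel.1 /
                rg⌋ : ℤ) : ℝ))
      else 0)| ≤
      (N : ℝ) * (C * (2 * b + ((K : ℝ) + 1) * (2 * rφ * (b + rg) + 2 * rg))) +
        C * b * D * ∑ i, ∫ s in (0 : ℝ)..h, ‖(Φ.flow s z i).2‖ := by
  refine (Finset.abs_sum_le_sum_abs _ _).trans ?_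
  refine (Finset.sum_le_sum fun i _ => Φ.abs_sum_range_ite_binnedJumpPayload_le hε hz i hh K hC hrφ
    hrg hD hφ1 hφD hg t₀).trans (le_of_eq ?_)
  rw [Finset.sum_add_distrib, Finset.sum_const, Finset.card_univ, Fintype.card_fin, nsmul_eq_mul,
    ← Finset.mul_sum]

end Flow

end Literature.MathematicalPhysics.KineticTheory

end
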